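import Summits.NavierStokesRegularity.FluidComputer.PalasekTowerHostPreparation

/-!
# Host preparation, XI: the host with a LATE-FADED force (hold-and-release), and the engine
# hypothesis under which it kills `HeredityAt 0`

Cell `ns-blowup`, seat `ns-blowup-ecbridge-1` (g6). LABEL: E–C typing (KERNEL construction + one named
ENGINE HYPOTHESIS). WHAT THIS IS NOT: not Navier–Stokes evidence — a second schedule for ecbridge-3's
PRESCRIBED host (`PalasekTowerHost*`, p418168–p428335) is written down, differing from `hostSchedule`
ONLY in where the force is faded out inside the first growth window; nothing is claimed about NS
dynamics. The register's level-`0` clauses are met exactly as before (they live on `[0, τ₀] = [0, 1]`,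
where both forces ARE the residual).

* §1 `forceL L L_b ε = fade τ₁ ε • resid` (`= resid` on `(-∞, τ₁ - ε]`, `= 0` from `τ₁`): Clay class,
  confined, push-small, silent — verbatim the lemmas of `PalasekTowerHostSchedule` §1 with the fade
  width `w₀` replaced by `ε ∈ (0, w₀]`;
* §2 `hostScheduleL` := `hostSchedule.reforce forceL` (pinned `Λ = 8, θ = 6/5`, rigid, quiet) and its
  level-`0` stage `Stage.reforceG` of ecbridge-3's stage (`nonempty_stage_zero_lateFade`);
* §3 the prescribed host `(vel, pres)` solves the forced system with force `resid` on EVERY slab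
  `[0, T]` (`isClassicalNSSolutionOn_vel_resid`; the momentum identity of `PalasekTowerHostFlow` is an
  algebraic identity at every time), hence with force `forceL` on `[0, τ₁ - ε]`
  (`isClassicalNSSolutionOn_vel_forceL`); finite energy at all times (`energy_vel_all`); a uniform
  `L²` bound for the residual slices on `[0, τ₁]` (`exists_lintegral_resid_sq_le`; `‖forceL‖ ≤ ‖resid‖`);
* §4 the ENGINE HYPOTHESIS `ForcedLerayShortTimeBound` (open here; never asserted): the FORCED twin of
  the tree's PROVED `Literature.Analysis.FluidPDE.exists_norm_le_two_mul_of_finiteEnergy_from`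
  (Leray 1934 §21 (3.15); Ożański–Pooley 2018 Lemma 6.23 (i)) — a finite-energy classical solution of
  the system forced by a Clay-class force with `L²`-bounded slices, starting below `A` in sup norm,
  stays below `2A + η` for a short time `δ₀(ν, A, F, η)`. It is the one analytic input of the
  hold-and-release refutation of the trap `FirstEpisode = HeredityAt 0`
  (`Theorems/EpisodeBase/Negative/…`): under it NO level-`1` stage of `hostScheduleL` exists once `ε`
  is small (uniqueness pins any such stage to the prescribed host, speed `≤ Y₀`, up to `τ₁ - ε`; the
  bound keeps it below `2Y₀ + η < Y₁ = 2^{1.04} Y₀` at `τ₁`).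

References: S. Palasek, arXiv:2605.13827 §3.3–§4 [cite: Palasek2026ElementaryModel, §3.3];
J. Leray, Acta Math. 63 (1934) §19 (3.8), §21 (3.15) [cite: Leray1934, §21 (3.15)];
W. S. Ożański, B. C. Pooley, LMS LN 452 (2018), Lemma 6.23 (i) [cite: OzanskiPooley2018, Lemma 6.23];
C. L. Fefferman, Clay problem description, (5) (6) [cite: FeffermanClay2006, (5) (6)].
-/

noncomputable section

namespace Summit.NavierStokesRegularity.FluidComputer.PalasekTowerClayBridge.Host

open Real Set Function Filter Topology InnerProductSpace Metric MeasureTheory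
open scoped RealInnerProductSpace ContDiff Topology Laplacian ENNReal

open Literature.Analysis.FluidPDE

/-- Local notation for physical space `ℝ³ = EuclideanSpace ℝ (Fin 3)`. -/
local notation "ℝ³" => EuclideanSpace ℝ (Fin 3)

/-! ## §1 The late-faded force -/

/-- **The late-faded force**: the residual of the prescribed host, faded out on `[τ₁ - ε, τ₁]` only,
`f(t) = fade_{τ₁, ε}(t) • resid(t)`. [folklore] -/
def forceL (L Lb ε : ℝ) (t : ℝ) (x : ℝ³) : ℝ³ := fade τfirst ε t • resid L Lb t x

section ForceL

variable {L Lb ε : ℝ}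

/-- On `(-∞, τ₁ - ε]` the late-faded force IS the residual. [folklore] -/
theorem forceL_eq_resid (hε : 0 < ε) {t : ℝ} (ht : t ≤ τfirst - ε) (x : ℝ³) :
    forceL L Lb ε t x = resid L Lb t x := by
  rw [forceL, fade_of_le hε ht, one_smul]

/-- From `τ₁` on the late-faded force vanishes. [folklore] -/
theorem forceL_eq_zero_of_ge (hε : 0 < ε) {t : ℝ} (ht : τfirst ≤ t) (x : ℝ³) : forceL L Lb ε t x = 0 := by
  rw [forceL, fade_of_ge hε ht, zero_smul]

/-- Outside the carrying ball the late-faded force vanishes. [folklore] -/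
theorem forceL_eq_zero_of_far (hL : 0 < L) (hLb : 0 < Lb) {x : ℝ³} (hx : radius L Lb < ‖x‖) (t : ℝ) :
    forceL L Lb ε t x = 0 := by
  rw [forceL, resid_eq_zero_of_far hL hLb hx, smul_zero]

/-- Before `t = 0` the late-faded force vanishes. [folklore] -/
theorem forceL_eq_zero_of_nonpos {t : ℝ} (ht : t ≤ 0) (x : ℝ³) : forceL L Lb ε t x = 0 := by
  rw [forceL, resid_eq_zero_of_nonpos ht, smul_zero]

/-- `‖f‖ ≤ ‖resid‖` (`0 ≤ fade ≤ 1`). [folklore] -/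
theorem norm_forceL_le (t : ℝ) (x : ℝ³) : ‖forceL L Lb ε t x‖ ≤ ‖resid L Lb t x‖ := by
  rw [forceL, norm_smul, Real.norm_eq_abs]
  exact mul_le_of_le_one_left (norm_nonneg _) (abs_fade_le_one t)

/-- **The late-faded force is smooth on `ℝ × ℝ³`.** [folklore] -/
theorem contDiff_uncurry_forceL : ContDiff ℝ ∞ (uncurry (forceL L Lb ε)) :=
  ((contDiff_fade _ _).comp contDiff_fst).smul contDiff_uncurry_resid

/-- **Clay (6)** for the late-faded force. [cite: FeffermanClay2006, (6)] -/
theorem isSmoothOnHalfSpace_forceL : IsSmoothOnHalfSpace (forceL L Lb ε) :=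
  contDiff_uncurry_forceL.contDiffOn

/-- The late-faded force is supported in the box `[0, τ₁] × B̄(0, radius)`. [folklore] -/
theorem tsupport_forceL_subset (hL : 0 < L) (hLb : 0 < Lb) (hε : 0 < ε) :
    tsupport (uncurry (forceL L Lb ε)) ⊆ Icc 0 τfirst ×ˢ Metric.closedBall (0 : ℝ³) (radius L Lb) := by
  refine closure_minimal (fun z hz => ?_) (isClosed_Icc.prod Metric.isClosed_closedBall)
  rw [mem_support] at hz
  refine mk_mem_prod ⟨?_, ?_⟩ ?_
  · by_contra h
    exact hz (forceL_eq_zero_of_nonpos (le_of_lt (not_le.mp h)) z.2)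
  · by_contra h
    exact hz (forceL_eq_zero_of_ge hε (le_of_lt (not_le.mp h)) z.2)
  · rw [Metric.mem_closedBall, dist_zero_right]
    by_contra h
    exact hz (forceL_eq_zero_of_far hL hLb (lt_of_not_ge h) z.1)

/-- **Clay (5)** for the late-faded force (smooth, supported in a compact box of the half-space).
[cite: FeffermanClay2006, (5)] -/
theorem hasRapidSpaceTimeDecay_forceL (hL : 0 < L) (hLb : 0 < Lb) (hε : 0 < ε) :
    HasRapidSpaceTimeDecay (forceL L Lb ε) := by
  intro n K
  set F := uncurry (forceL L Lb ε) with hFdef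
  have hF : ContDiff ℝ ∞ F := contDiff_uncurry_forceL
  have hUD : UniqueDiffOn ℝ (Ici (0 : ℝ) ×ˢ (univ : Set ℝ³)) :=
    (uniqueDiffOn_Ici 0).prod uniqueDiffOn_univ
  have hwithin : ∀ z ∈ Ici (0 : ℝ) ×ˢ (univ : Set ℝ³),
      iteratedFDerivWithin ℝ n F (Ici (0 : ℝ) ×ˢ univ) z = iteratedFDeriv ℝ n F z := fun z hz =>
    iteratedFDerivWithin_eq_iteratedFDeriv hUD (hF.contDiffAt.of_le (by exact_mod_cast le_top)) hz
  set Φ : ℝ × ℝ³ → ℝ := fun z => (1 + ‖z.2‖ + z.1) ^ K * ‖iteratedFDeriv ℝ n F z‖ with hΦdef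
  have hΦc : Continuous Φ := by
    have h1 : Continuous fun z : ℝ × ℝ³ => (1 + ‖z.2‖ + z.1) ^ K :=
      ((continuous_const.add continuous_snd.norm).add continuous_fst).pow K
    exact h1.mul (hF.continuous_iteratedFDeriv (m := n) (by exact_mod_cast le_top)).norm
  have hbox : IsCompact (Icc (0 : ℝ) τfirst ×ˢ Metric.closedBall (0 : ℝ³) (radius L Lb)) :=
    isCompact_Icc.prod (isCompact_closedBall _ _)
  obtain ⟨C, hC⟩ := hbox.exists_bound_of_continuousOn hΦc.continuousOn
  refine ⟨max C 0, fun t ht x => ?_⟩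
  have hz : ((t, x) : ℝ × ℝ³) ∈ Ici (0 : ℝ) ×ˢ (univ : Set ℝ³) := mk_mem_prod ht (mem_univ _)
  rw [hwithin _ hz]
  by_cases hmem : ((t, x) : ℝ × ℝ³) ∈ Icc (0 : ℝ) τfirst ×ˢ Metric.closedBall (0 : ℝ³) (radius L Lb)
  · have := hC _ hmem
    simp only [hΦdef, Real.norm_eq_abs] at this
    exact le_trans (le_trans (le_abs_self _) this) (le_max_left _ _)
  · have hnot : ((t, x) : ℝ × ℝ³) ∉ tsupport F :=
      fun hts => hmem (tsupport_forceL_subset hL hLb hε hts)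
    have hzero : iteratedFDeriv ℝ n F (t, x) = 0 :=
      Function.notMem_support.mp fun h => hnot (support_iteratedFDeriv_subset n h)
    rw [hzero, norm_zero, mul_zero]
    exact le_max_right _ _

end ForceL

/-! ## §2 The late-fade schedule and its level-`0` stage -/

section ScheduleL

variable {L Lb ε : ℝ}

/-- `τ₁` is before the blow-up time of the host schedule. [folklore] -/
theorem τfirst_lt_T (hL : 1 ≤ L) (hLb : 1 ≤ Lb)
    (hpush : ∀ t ∈ Icc (1 : ℝ) τfirst, ∀ x : ℝ³, ‖resid L Lb t x‖ ≤ 1 / 200 * TowerRates.wide.Y 0) :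
    τfirst < (hostSchedule L Lb hL hLb hpush).T := by
  rw [← hostSchedule_τ_one hL hLb hpush]
  exact (hostSchedule L Lb hL hLb hpush).τ_lt_T 1

/-- The late-faded force is silent from the blow-up time `T` of the host schedule on. [folklore] -/
theorem forceL_silent (hL : 1 ≤ L) (hLb : 1 ≤ Lb) (hε : 0 < ε)
    (hpush : ∀ t ∈ Icc (1 : ℝ) τfirst, ∀ x : ℝ³, ‖resid L Lb t x‖ ≤ 1 / 200 * TowerRates.wide.Y 0) :
    ∀ t, (hostSchedule L Lb hL hLb hpush).T ≤ t → ∀ x : ℝ³, forceL L Lb ε t x = 0 :=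
  fun _ ht x => forceL_eq_zero_of_ge hε ((τfirst_lt_T hL hLb hpush).le.trans ht) x

/-- The late-faded force is push-small on the growth windows of the host schedule (`≤ Y₀/200` on the
first window, `0` on the later ones). [folklore] -/
theorem forceL_push_small (hL : 1 ≤ L) (hLb : 1 ≤ Lb) (hε : 0 < ε)
    (hpush : ∀ t ∈ Icc (1 : ℝ) τfirst, ∀ x : ℝ³, ‖resid L Lb t x‖ ≤ 1 / 200 * TowerRates.wide.Y 0) :
    ∀ k, ∀ t ∈ Icc ((hostSchedule L Lb hL hLb hpush).τ k) ((hostSchedule L Lb hL hLb hpush).τ (k + 1)),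
      ∀ x : ℝ³, ‖forceL L Lb ε t x‖ ≤ (hostSchedule L Lb hL hLb hpush).c₄ * TowerRates.wide.Y k := by
  intro k t ht x
  show ‖forceL L Lb ε t x‖ ≤ 1 / 200 * TowerRates.wide.Y k
  rw [hostSchedule_τ] at ht
  rcases Nat.eq_zero_or_pos k with hk | hk
  · subst hk
    rw [windowTime_zero] at ht
    have ht' : t ∈ Icc (1 : ℝ) τfirst := ⟨ht.1, ht.2⟩
    exact (norm_forceL_le t x).trans (hpush t ht' x)
  · have h1 : τfirst ≤ t := le_trans (windowTime_mono hk) ht.1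
    rw [forceL_eq_zero_of_ge hε h1 x, norm_zero]
    have hY : 0 < TowerRates.wide.Y k := Real.rpow_pos_of_pos (TowerRates.wide.N_pos k) _
    positivity

/-- **THE LATE-FADE SCHEDULE**: ecbridge-3's `hostSchedule` re-forced by `forceL` (same clock, constants,
ball and zero datum). [cite: Palasek2026ElementaryModel, §3.3] -/
def hostScheduleL (L Lb ε : ℝ) (hL : 1 ≤ L) (hLb : 1 ≤ Lb) (hε : 0 < ε)
    (hpush : ∀ t ∈ Icc (1 : ℝ) τfirst, ∀ x : ℝ³, ‖resid L Lb t x‖ ≤ 1 / 200 * TowerRates.wide.Y 0) :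
    Schedule TowerRates.wide :=
  (hostSchedule L Lb hL hLb hpush).reforce (forceL L Lb ε) isSmoothOnHalfSpace_forceL
    (hasRapidSpaceTimeDecay_forceL (by linarith) (by linarith) hε) (forceL_silent hL hLb hε hpush)
    (forceL_push_small hL hLb hε hpush)

variable (hL : 1 ≤ L) (hLb : 1 ≤ Lb) (hε : 0 < ε)
  (hpush : ∀ t ∈ Icc (1 : ℝ) τfirst, ∀ x : ℝ³, ‖resid L Lb t x‖ ≤ 1 / 200 * TowerRates.wide.Y 0)

/-- The force of the late-fade schedule. [folklore] -/
@[simp] theorem hostScheduleL_f : (hostScheduleL L Lb ε hL hLb hε hpush).f = forceL L Lb ε := rfl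

/-- `τ 0 = 1`. [folklore] -/
theorem hostScheduleL_τ_zero : (hostScheduleL L Lb ε hL hLb hε hpush).τ 0 = 1 := windowTime_zero

/-- `τ 1 = τ₁`. [folklore] -/
theorem hostScheduleL_τ_one : (hostScheduleL L Lb ε hL hLb hε hpush).τ 1 = τfirst := rfl

/-- `c₁ = 1`. [folklore] -/
theorem hostScheduleL_c₁ : (hostScheduleL L Lb ε hL hLb hε hpush).c₁ = 1 := rfl

/-- `c₂ = 5/3`. [folklore] -/
theorem hostScheduleL_c₂ : (hostScheduleL L Lb ε hL hLb hε hpush).c₂ = 5 / 3 := rfl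

/-- The datum is zero. [folklore] -/
theorem hostScheduleL_u₀ : (hostScheduleL L Lb ε hL hLb hε hpush).u₀ = 0 := rfl

/-- **RIGID.** [folklore] -/
theorem hostScheduleL_rigid : (hostScheduleL L Lb ε hL hLb hε hpush).Rigid :=
  (hostSchedule_rigid hL hLb hpush).reforce

/-- **QUIET** (the force vanishes from `τ 1 = τ₁` on). [folklore] -/
theorem hostScheduleL_quiet : (hostScheduleL L Lb ε hL hLb hε hpush).Quiet := by
  intro t ht
  funext x
  exact forceL_eq_zero_of_ge hε ht x

/-- **PINNED** with `Λ = 8`, `θ = 6/5` (the pins survive re-forcing by a confined force). [folklore] -/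
theorem hostScheduleL_pins : (hostScheduleL L Lb ε hL hLb hε hpush).Pins 8 (6 / 5) :=
  (hostSchedule_pins hL hLb hpush).reforce
    (fun t x hx => forceL_eq_zero_of_far (by linarith) (by linarith) hx t)

include hε in
/-- The two forces agree on `[0, τ₀] = [0, 1]` (both are the residual there; needs `ε ≤ w₀`).
[folklore] -/
theorem forceL_eq_force_of_le_one (hεw : ε ≤ wfirst) {t : ℝ} (ht : t ≤ 1) (x : ℝ³) :
    forceL L Lb ε t x = force L Lb t x := by
  have h1 : t ≤ τfirst - ε := by rw [τfirst_eq]; linarith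
  rw [forceL_eq_resid hε h1, force_eq_resid ht]

/-- **The level-`0` stage of the late-fade schedule**: ecbridge-3's registered host stage, transported
along the re-forcing (the stage lives on `[0, 1]`, where the two forces agree). [cite: Palasek2026ElementaryModel, §4] -/
theorem nonempty_stage_zero_lateFade (hεw : ε ≤ wfirst) (hslab : ∀ x : ℝ³, ‖slab L x‖ ≤ 11 / 10 * freq) :
    Nonempty (Stage 1 TowerRates.wide (hostScheduleL L Lb ε hL hLb hε hpush)
      (Margins.routeG TowerRates.wide) 0) := by
  obtain ⟨s₀⟩ := stage_of_scales hL hLb hslab hpush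
  refine ⟨s₀.reforceG (forceL L Lb ε) isSmoothOnHalfSpace_forceL
    (hasRapidSpaceTimeDecay_forceL (by linarith) (by linarith) hε) (forceL_silent hL hLb hε hpush)
    (forceL_push_small hL hLb hε hpush) ?_⟩
  intro t ht x
  rw [hostSchedule_τ_zero] at ht
  rw [hostSchedule_f]
  exact forceL_eq_force_of_le_one hε hεw ht.2 x

end ScheduleL

/-! ## §3 The prescribed host solves the forced system on every slab; sizes at all times -/

section Slab

variable {L Lb : ℝ}

/-- The one-sided time derivative of the host velocity within any slab `[0, T]`. [folklore] -/
theorem timeDerivWithin_vel_slab {T t : ℝ} (hT : 0 < T) (ht : t ∈ Icc (0 : ℝ) T) (x : ℝ³) :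
    timeDerivWithin (Icc 0 T) (vel L Lb) t x = deriv aProf t • bumpF L Lb x + deriv bProf t • slab L x := by
  rw [timeDerivWithin_apply]
  exact (hasDerivAt_vel t x).hasDerivWithinAt.derivWithin (uniqueDiffOn_Icc hT t ht)

/-- **The momentum identity at every time** `∂ₜu + (u·∇)u = Δu − ∇p + resid` (an algebraic identity of
the prescribed fields; verbatim `momentum_vel` of `PalasekTowerHostFlow` on a general slab).
[cite: MajdaBertozziCUP2002, §2.3.2] -/
theorem momentum_vel_slab (hL : 0 < L) (hLb : 0 < Lb) {T t : ℝ} (hT : 0 < T) (ht : t ∈ Icc (0 : ℝ) T)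
    (x : ℝ³) :
    timeDerivWithin (Icc 0 T) (vel L Lb) t x + convect (vel L Lb t) (vel L Lb t) x =
      (1 : ℝ) • (Δ (vel L Lb t)) x - gradient (pres L t) x + resid L Lb t x := by
  have hΔb : (Δ (bumpF L Lb)) x = -curl (curl (bumpF L Lb)) x := laplacian_place_theta _ _ _
  have hΔs : (Δ (slab L)) x =
      -(freq ^ 2 • slab L x + freq • slabDefect L x + curl (slabDefect L) x) :=
    laplacian_packet (contDiff_cutoff L) x
  have hcv : convect (slab L) (slab L) x =
      cross (slabDefect L x) (slab L x) + gradient (fun y => ‖slab L y‖ ^ 2 / 2) x :=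
    convect_packet (contDiff_cutoff L) x
  rw [timeDerivWithin_vel_slab hT ht, convect_vel hL hLb, laplacian_vel, gradient_pres, one_smul, hΔb,
    hΔs, hcv]
  simp only [resid]
  module

/-- **The host solves forced Navier–Stokes with force `resid` on every slab `[0, T] × ℝ³`**, at unit
viscosity. [cite: FeffermanClay2006, (1) (2)] -/
theorem isClassicalNSSolutionOn_vel_resid (hL : 0 < L) (hLb : 0 < Lb) {T : ℝ} (hT : 0 < T) :
    IsClassicalNSSolutionOn (Icc 0 T) 1 (resid L Lb) (vel L Lb) (pres L) where
  smooth_velocity := contDiff_uncurry_vel.contDiffOn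
  smooth_pressure := contDiff_uncurry_pres.contDiffOn
  momentum _ ht x := momentum_vel_slab hL hLb hT ht x
  divFree t _ := isDivFree_vel t

/-- **… hence with the late-faded force on `[0, τ₁ − ε]`** (where `forceL = resid`).
[cite: FeffermanClay2006, (1) (2)] -/
theorem isClassicalNSSolutionOn_vel_forceL (hL : 0 < L) (hLb : 0 < Lb) {ε : ℝ} (hε : 0 < ε)
    (hε1 : ε < τfirst) :
    IsClassicalNSSolutionOn (Icc 0 (τfirst - ε)) 1 (forceL L Lb ε) (vel L Lb) (pres L) where
  smooth_velocity := contDiff_uncurry_vel.contDiffOn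
  smooth_pressure := contDiff_uncurry_pres.contDiffOn
  momentum t ht x := by
    rw [forceL_eq_resid hε ht.2]
    exact momentum_vel_slab hL hLb (by linarith) ht x
  divFree t _ := isDivFree_vel t

/-- **Finite energy at all times**: the velocity is bounded by `Y₀` and supported in `B̄(0, radius)`
at every time (verbatim `energy_vel`, whose proof never used `t ≤ 1`). [folklore] -/
theorem energy_vel_all (hL : 0 < L) (hLb : 0 < Lb) (hslab : ∀ y, ‖slab L y‖ ≤ 11 / 10 * freq) :
    ∃ C : ℝ≥0∞, C < ⊤ ∧ ∀ t : ℝ, ∫⁻ x, ‖vel L Lb t x‖ₑ ^ 2 ≤ C := by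
  set B := Metric.closedBall (0 : ℝ³) (radius L Lb) with hB
  refine ⟨ENNReal.ofReal (TowerRates.wide.Y 0) ^ 2 * volume B,
    ENNReal.mul_lt_top (by simp) measure_closedBall_lt_top, fun t => ?_⟩
  have hpt : ∀ x, ‖vel L Lb t x‖ₑ ^ 2 ≤
      B.indicator (fun _ => ENNReal.ofReal (TowerRates.wide.Y 0) ^ 2) x := by
    intro x
    by_cases hx : x ∈ B
    · rw [indicator_of_mem hx, ← ofReal_norm]
      exact pow_le_pow_left' (ENNReal.ofReal_le_ofReal (norm_vel_le hL hLb hslab t x)) 2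
    · have hx' : radius L Lb < ‖x‖ := by
        rw [hB, Metric.mem_closedBall, dist_zero_right, not_le] at hx
        exact hx
      rw [vel_eq_zero_of_far hL hLb hx' t, indicator_of_notMem hx]
      simp
  calc ∫⁻ x, ‖vel L Lb t x‖ₑ ^ 2
      ≤ ∫⁻ x, B.indicator (fun _ => ENNReal.ofReal (TowerRates.wide.Y 0) ^ 2) x := lintegral_mono hpt
    _ = ENNReal.ofReal (TowerRates.wide.Y 0) ^ 2 * volume B :=
        lintegral_indicator_const measurableSet_closedBall _

/-- **A uniform `L²` bound for the residual slices on `[0, τ₁]`**: the residual is jointly continuous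
and supported in the fixed ball, so `∫ |resid(t)|² ≤ M² · vol B̄(0, radius)` with
`M = max |resid|` over the compact box. [folklore] -/
theorem exists_lintegral_resid_sq_le (hL : 0 < L) (hLb : 0 < Lb) :
    ∃ F : ℝ, 0 ≤ F ∧ ∀ t ∈ Icc (0 : ℝ) τfirst, ∫⁻ x, ‖resid L Lb t x‖ₑ ^ 2 ≤ ENNReal.ofReal (F ^ 2) := by
  set B := Metric.closedBall (0 : ℝ³) (radius L Lb) with hB
  have hbox : IsCompact (Icc (0 : ℝ) τfirst ×ˢ B) := isCompact_Icc.prod (isCompact_closedBall _ _)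
  have hc : Continuous fun z : ℝ × ℝ³ => ‖uncurry (resid L Lb) z‖ :=
    (contDiff_uncurry_resid.continuous).norm
  obtain ⟨M, hM⟩ := hbox.exists_bound_of_continuousOn hc.continuousOn
  have hM0 : 0 ≤ M := by
    have h := hM (0, 0) (mk_mem_prod ⟨le_rfl, by rw [τfirst_eq]; linarith [wfirst_pos]⟩
      (by rw [hB, Metric.mem_closedBall, dist_zero_right, norm_zero]
          show (0 : ℝ) ≤ 2 * L + 4 * Lb + 2; positivity))
    exact le_trans (norm_nonneg _) h
  -- `F² := M² · (vol B).toReal`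
  have hvol : volume B < ⊤ := measure_closedBall_lt_top
  refine ⟨M * Real.sqrt (volume B).toReal, by positivity, fun t ht => ?_⟩
  have hpt : ∀ x, ‖resid L Lb t x‖ₑ ^ 2 ≤ B.indicator (fun _ => ENNReal.ofReal M ^ 2) x := by
    intro x
    by_cases hx : x ∈ B
    · rw [indicator_of_mem hx, ← ofReal_norm]
      have h := hM (t, x) (mk_mem_prod ht hx)
      simp only [uncurry_apply_pair, Real.norm_eq_abs, abs_norm] at h
      exact pow_le_pow_left' (ENNReal.ofReal_le_ofReal h) 2
    · have hx' : radius L Lb < ‖x‖ := by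
        rw [hB, Metric.mem_closedBall, dist_zero_right, not_le] at hx
        exact hx
      rw [resid_eq_zero_of_far hL hLb hx' t, indicator_of_notMem hx]
      simp
  calc ∫⁻ x, ‖resid L Lb t x‖ₑ ^ 2
      ≤ ∫⁻ x, B.indicator (fun _ => ENNReal.ofReal M ^ 2) x := lintegral_mono hpt
    _ = ENNReal.ofReal M ^ 2 * volume B := lintegral_indicator_const measurableSet_closedBall _
    _ = ENNReal.ofReal ((M * Real.sqrt (volume B).toReal) ^ 2) := by
        rw [mul_pow, Real.sq_sqrt ENNReal.toReal_nonneg, ENNReal.ofReal_mul (sq_nonneg M),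
          ENNReal.ofReal_pow hM0, ENNReal.ofReal_toReal hvol.ne]

end Slab

/-! ## §4 The engine hypothesis (open here; never asserted) -/

/-- **ENGINE HYPOTHESIS — the short-time sup bound WITH a Clay force, a-priori form** (open in the
tree; never asserted; the FORCED twin of the PROVED `Literature.Analysis.FluidPDE.exists_norm_le_two_mul_of_finiteEnergy_from`
of `ClassicalShortTimeSupBound.lean`, in the weaker A-PRIORI form where a sup bound `M` on the slab is
GIVEN): for every viscosity `ν > 0`, initial level `A > 0`, a-priori bound `M > 0`, force size `F ≥ 0`
and tolerance `η > 0` there is `δ₀ > 0` such that a finite-energy classical solution `(u, p)` of the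
Navier–Stokes system on a slab `[t₀, T] × ℝ³` (`0 ≤ t₀ < T`, `T - t₀ ≤ δ₀`) forced by a Clay-class
`f` whose slices have `∫ |f(t)|² ≤ F²`, with `|u| ≤ M` on the slab and `|u(t₀, ·)| ≤ A`, satisfies
`|u(t, x)| ≤ 2A + η` on the slab. Expected proof (not in the tree; every input exists there): the
tested Duhamel formula WITH force for the Leray–Hopf solution that `u` is
(`IsLerayHopfOn.integral_inner_eq_mild_of_hasWeakGradient_forced`, via
`isLerayHopfOn_of_finiteEnergy_forced_ae` + `tao2011_forced_pressure_normalisation_ae_holds`), tested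
against `P(G_ε(· - x₀) e)` as in `enorm_sub_heatExtension_le_speedMajorant_forced`
(`TaoForcedBoundedTotalSpeed.lean`), with the nonlinear term bounded in PHYSICAL space by the Oseen
kernel, `|⟨u ⊗ u, ∇e^{νσΔ}P φ⟩| ≤ C (νσ)^{-1/2} M² ‖φ‖₁`, and the force term by
`‖e^{νσΔ}P f‖_∞ ≤ C (νσ)^{-3/4} ‖f‖₂` (`eLpNorm_lerayHeatTest_le`): `|u(t,x)| ≤ A + 2C√(δ₀/ν) M² +
4C ν^{-3/4} δ₀^{1/4} F ≤ 2A + η` for `δ₀` small. [cite: Leray1934, §21 (3.15)] [cite: OzanskiPooley2018, Lemma 6.23] -/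
@[conjecture] def ForcedLerayShortTimeBound : Prop :=
  ∀ ⦃ν A M F η : ℝ⦄, 0 < ν → 0 < A → 0 < M → 0 ≤ F → 0 < η → ∃ δ₀ : ℝ, 0 < δ₀ ∧
    ∀ ⦃t₀ T : ℝ⦄ ⦃f u : ℝ → ℝ³ → ℝ³⦄ ⦃p : ℝ → ℝ³ → ℝ⦄, 0 ≤ t₀ → t₀ < T → T - t₀ ≤ δ₀ →
      IsSmoothOnHalfSpace f → HasRapidSpaceTimeDecay f →
      (∀ t ∈ Icc t₀ T, ∫⁻ x, ‖f t x‖ₑ ^ 2 ≤ ENNReal.ofReal (F ^ 2)) →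
      IsClassicalNSSolutionOn (Icc t₀ T) ν f u p →
      (∃ C : ℝ≥0∞, C < ⊤ ∧ ∀ t ∈ Icc t₀ T, ∫⁻ x, ‖u t x‖ₑ ^ 2 ≤ C) →
      (∀ t ∈ Icc t₀ T, ∀ x, ‖u t x‖ ≤ M) →
      (∀ x, ‖u t₀ x‖ ≤ A) →
      ∀ t ∈ Icc t₀ T, ∀ x, ‖u t x‖ ≤ 2 * A + η

end Summit.NavierStokesRegularity.FluidComputer.PalasekTowerClayBridge.Host

end
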